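import Summits.CriticalPhenomena.PercolationContinuityZ3.Theorems.PercNearOneGluingNoHeavyLowerTailSahiTransportJRTables

/-!
# `NoHeavyLowerTail` (crux stmt-CriticalPhenomena-4575), Sahi / Kahn positivity: THREE-SAMPLE parameter-free transport certificates — tables and check

Support file (cell `prim-l12`, seat P3, gen 5; `--supports stmt-CriticalPhenomena-4575`).  Computable definitions and data only.

`…SahiTransportJRTables` certifies tables `c(η, ζ, T)` giving `θδ·ρ(T) = Σ_{η,ζ} w(η)w(ζ)c(η,ζ,T)` (two independent samples `η ~ w(·|Hᶜ)`,
`ζ ~ w(·|H)`).  For the type `K₂,₂ = ⟨ac,bc,ad,bd⟩` of `2^4` no such parameter-free table has all degree-3 fibres nonnegative (LP optimum `−1/6`,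
kit j103666/j104652), but with a THIRD independent sample `ξ ~ w` selecting the branch — `θδ·ρ(T) = Σ_{η,ζ,ξ} w(η)w(ζ)w(ξ)c(η,ζ,ξ,T)`, still of
multidegree `≤ 3` — a DETERMINISTIC table exists (kit j104793; exact re-verification of all fibres for the three masks `61152, 64200, 64680`).
This file: tables `Tab3 = ct[η][ζ][ξ][T]` (scaled by `DEN`), `structTab3`, the Kronecker numbers `tcZ3`/`aZ3` of the scaled rows (cache `prodTab3` of
`K(2^η)K(2^ζ)K(2^ξ)`), the check `checkTab3 σ m M ct`, the sparse data `certData4K22` and `certTab4K22`.  Soundness: `…SahiTransportJR3Sound`. [this work]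
-/

namespace Summit.CriticalPhenomena.PercolationContinuityZ3.Theorems.SahiTransportJR

open SahiC3Cube SahiTransportCheck OneCutCert CovTransferCert

/-- A three-sample coefficient table: `ct[η][ζ][ξ][T] = DEN·c(η,ζ,ξ,T)`. [this work] -/
abbrev Tab3 := List (List (List (List ℤ)))

/-- Table access with default `0`. [this work] -/
def get4 (t : Tab3) (a b c d : ℕ) : ℤ := (((t.getD a []).getD b []).getD c []).getD d 0

/-- STRUCTURAL TEST: for `η ∉ H ∋ ζ` and every `ξ` the entries are nonnegative, sum to `DEN`, and are supported on `T ∈ H` with `η ⊆ T`. [this work] -/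
def structTab3 (m M : ℕ) (ct : Tab3) : Bool :=
  (pts m (cpl m M)).all fun η => (pts m M).all fun ζ => (List.range (2 ^ m)).all fun ξ =>
    ((List.range (2 ^ m)).all fun T =>
      decide (0 ≤ get4 ct η ζ ξ T) && (decide (get4 ct η ζ ξ T = 0) || (psub η T && M.testBit T))) &&
    decide ((((List.range (2 ^ m)).map fun T => get4 ct η ζ ξ T).sum) = (DEN : ℤ))

/-- Cache of the products `K(2^η)·K(2^ζ)·K(2^ξ)`. [this work] -/
def prodTab3 (σ m : ℕ) : List (List (List ℤ)) :=
  (List.range (2 ^ m)).map fun η => (List.range (2 ^ m)).map fun ζ => (List.range (2 ^ m)).map fun ξ =>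
    (krT σ m (2 ^ η) : ℤ) * (krT σ m (2 ^ ζ) : ℤ) * (krT σ m (2 ^ ξ) : ℤ)

/-- The table mass sent into `K`: `Σ_{T ∈ H ∩ K} ct[η][ζ][ξ][T]`. [this work] -/
def massK3 (m M : ℕ) (ct : Tab3) (K η ζ ξ : ℕ) : ℤ := ((pts m (M &&& K)).map fun T => get4 ct η ζ ξ T).sum

/-- The Kronecker number of `DEN·θδ·ρ(K)` for a three-sample table. [this work] -/
def rhoZ3 (m M : ℕ) (ct : Tab3) (pt : List (List (List ℤ))) (K : ℕ) : ℤ :=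
  ((pts m (cpl m M)).map fun η => ((pts m M).map fun ζ => ((List.range (2 ^ m)).map fun ξ =>
    massK3 m M ct K η ζ ξ * get3 pt η ζ ξ).sum).sum).sum

/-- The Kronecker number of the scaled (TC) row at `(X, Z)` (three-sample table). [this work] -/
def tcZ3 (σ m M : ℕ) (ct : Tab3) (pt : List (List (List ℤ))) (kF kD : ℤ) (X Z : ℕ) : ℤ :=
  let D := cpl m M; let K := X &&& Z
  let kX : ℤ := krT σ m X; let kZ : ℤ := krT σ m Z; let kK : ℤ := krT σ m K
  let kDK : ℤ := krT σ m (D &&& K); let kDZ : ℤ := krT σ m (D &&& Z); let kDX : ℤ := krT σ m (D &&& X)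
  (DEN : ℤ) * (kF * kF * kK + kD * kF * kK - kF * kX * kZ - kD * kX * kZ - kF * kF * kDK - kD * kF * kDK + kX * kDZ * kF + kZ * kDX * kF)
    - rhoZ3 m M ct pt K

/-- The Kronecker number of the scaled capacity row at the pattern `t` (three-sample table). [this work] -/
def aZ3 (σ m M : ℕ) (ct : Tab3) (pt : List (List (List ℤ))) (kF kD : ℤ) (t : ℕ) : ℤ :=
  let kt : ℤ := krT σ m (2 ^ t)
  (DEN : ℤ) * (kF * kF * kt + kD * kF * kt) - rhoZ3 m M ct pt (2 ^ t)

/-- Coefficient budget of the three-sample rows: `DEN·(8 + 8^m)`. [this work] -/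
def BND3 (m : ℕ) : ℕ := DEN * (8 + 8 ^ m)

/-- **The check of a three-sample parameter-free certificate table** for the pattern event `M` on `2^m`. [this work] -/
def checkTab3 (σ m M : ℕ) (ct : Tab3) : Bool :=
  let pt := prodTab3 σ m
  let kF : ℤ := krT σ m (fullN m); let kD : ℤ := krT σ m (cpl m M)
  let off := offT σ m; let offN := off.toNat
  let ups := upsN m
  decide (0 < σ) && decide (BND3 m * 8 ^ m < 2 ^ (σ - 1)) && structTab3 m M ct &&
    ((pts m M).all fun t => rowOK off offN (aZ3 σ m M ct pt kF kD t)) &&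
    (ups.all fun X => ups.all fun Z => decide (Z < X) || rowOK off offN (tcZ3 σ m M ct pt kF kD X Z))

end Summit.CriticalPhenomena.PercolationContinuityZ3.Theorems.SahiTransportJR
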